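import Literature.MathematicalPhysics.QuantumLattice.XYZGroundStateOrderGD
import Literature.MathematicalPhysics.QuantumLattice.XYZGroundStateOrderProofs
import HarnessLib

/-!
# The Kennedy–Lieb–Shastry sublattice rotation of the easy-plane XXZ torus, with all its single-site actions

Trunk T-QLATTICE; companion of `XYOrderGDProofs.lean` (KLS, XY model), `XYZGroundStateOrderGD.lean`
(Björnberg–Ueltschi real-field form) and `HeisenbergOrderDLSProofs.exists_sublatticeRotation`
(the rotation about the `2`-axis used for the antiferromagnet). For the FERROMAGNETIC-XY /
antiferromagnetic-Ising torus `H(Δ) = xxzHamiltonian n (torusGraph d (2k)) (-1) Δ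
= -Σ_⟨xy⟩ (S¹S¹ + S²S² + Δ S³S³)` the rotation that produces a reflection-positive real form is the
rotation by `π` about the `1`-axis on the odd sublattice (Kennedy–Lieb–Shastry, J. Stat. Phys. 53
(1988), eqs. (15)–(17); Dyson–Lieb–Simon 1978 §2): it FIXES `S¹`, flips `S²`, `S³` on odd sites,
hence fixes the `S¹S¹` bonds and flips the `S²S²`, `S³S³` bonds of the bipartite even torus.

* `exists_sublatticeHalfTurnX` — a product unitary `W` and a sublattice sign `sgn = ±1` with
  `W S¹_x Wᴴ = S¹_x`, `W S²_x Wᴴ = sgn_x S²_x`, `W S³_x Wᴴ = sgn_x S³_x`, `sgn_x sgn_y = -1` on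
  edges, `sgn(θx) = -sgn(x)` for every reflection `θ` between sites, and the two conjugation
  identities the reflection-positivity arguments of the tree consume:
  `W H(0) Wᴴ = xyRealFieldHamiltonian (2k) n 0` (KLS eq. (17) at zero field) and, for `Δ < 0`,
  `W H(Δ) Wᴴ = (-Δ) · xyzRealFieldHamiltonian (2k) n s² (-s²) 0`, `s² = 1/(-Δ)` (Björnberg–Ueltschi's
  real form, `J₃ = 1`).

The versions `AnisotropyChord.exists_sublatticeRotation` / `LevyLogBootstrap.exists_sublatticeRotation_xxz`
under `Summits/HubbardSuperconductivity` export only the `S³` action; the `S¹` action (invariance)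
is what transports two-point functions `⟨S¹_x S¹_y⟩` through the rotation unchanged
(reflection positivity of ground-state correlation kernels, `GroundStateReflectionPositivity.lean`).

## References

* [KLS1988JSP] T. Kennedy, E. H. Lieb, B. S. Shastry, J. Stat. Phys. 53 (1988) 1019–1030,
  eqs. (15)–(17).
* [DLS1978] F. J. Dyson, E. H. Lieb, B. Simon, J. Stat. Phys. 18 (1978) 335–383, §2.
-/

noncomputable section

namespace Literature.MathematicalPhysics.QuantumLattice

open Matrix Finset Literature.Probability.LatticeModels
open scoped Kronecker

variable {d : ℕ}

/-- **The KLS sublattice rotation about the `1`-axis, with all single-site actions**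
(Kennedy–Lieb–Shastry, J. Stat. Phys. 53 (1988), eqs. (15)–(17); Dyson–Lieb–Simon 1978 §2).
On the even torus `(ℤ/2kℤ)^d` there are a product unitary `W` (the rotation by `π` about the
`1`-axis on the odd sublattice) and a sign `sgn = ±1` (the sublattice sign) such that
`W S¹_x Wᴴ = S¹_x`, `W S²_x Wᴴ = sgn_x S²_x`, `W S³_x Wᴴ = sgn_x S³_x`; adjacent sites have opposite
signs and every reflection between sites exchanges the sublattices; consequently
`W H(0) Wᴴ = H♭(0)` (`xyRealFieldHamiltonian`, KLS eq. (17) at zero field) and, for `Δ < 0` and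
`s² = 1/(-Δ)`, `W H(Δ) Wᴴ = (-Δ)·H'_{BU}(s², -s², 0)` (`xyzRealFieldHamiltonian`), where
`H(Δ) = xxzHamiltonian n (torusGraph d (2k)) (-1) Δ`. [cite: KLS1988JSP, eqs. (15)–(17)] -/
theorem exists_sublatticeHalfTurnX (k : ℕ) [NeZero (2 * k)] (n : ℕ) :
    ∃ (W : Op (TorusSite d (2 * k)) (n + 1)) (sgn : TorusSite d (2 * k) → ℂ),
      W * Wᴴ = 1 ∧ Wᴴ * W = 1 ∧
      (∀ x, W * siteSpin n x 0 * Wᴴ = siteSpin n x 0) ∧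
      (∀ x, W * siteSpin n x 1 * Wᴴ = sgn x • siteSpin n x 1) ∧
      (∀ x, W * siteSpin n x 2 * Wᴴ = sgn x • siteSpin n x 2) ∧
      (∀ x, sgn x = 1 ∨ sgn x = -1) ∧
      (∀ x y, (torusGraph d (2 * k)).Adj x y → sgn x * sgn y = -1) ∧
      (∀ (j : Fin d) (a : ZMod (2 * k)) (x : TorusSite d (2 * k)),
        sgn (Torus.reflectBetweenSites j a x) = -sgn x) ∧
      W * xyTorus d (2 * k) n * Wᴴ = xyRealFieldHamiltonian (2 * k) n 0 ∧
      (∀ Δ : ℝ, Δ < 0 →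
        W * xxzHamiltonian n (torusGraph d (2 * k)) (-1) Δ * Wᴴ =
          ((-Δ : ℝ) : ℂ) • xyzRealFieldHamiltonian (2 * k) n (Real.sqrt (-Δ)⁻¹ ^ 2)
            (-(Real.sqrt (-Δ)⁻¹ ^ 2)) 0) := by
  obtain ⟨T, hT, hT', hTx, hTy, hTz⟩ := exists_halfTurn_x n
  set E := (torusGraph d (2 * k)).edgeFinset with hE
  -- parity, single-site unitaries, signs
  set ε : TorusSite d (2 * k) → ZMod 2 := fun x =>
    ∑ j, ZMod.castHom (dvd_mul_right 2 k) (ZMod 2) (x j) with hε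
  set u : TorusSite d (2 * k) → Matrix (Fin (n + 1)) (Fin (n + 1)) ℂ :=
    fun z => if ε z = 0 then 1 else T with hu
  set sgn : TorusSite d (2 * k) → ℂ := fun z => if ε z = 0 then 1 else -1 with hsgn
  have hua : ∀ z, u z * (u z)ᴴ = 1 := by
    intro z; simp only [hu]; split_ifs
    · rw [conjTranspose_one, Matrix.mul_one]
    · exact hT
  have hua' : ∀ z, (u z)ᴴ * u z = 1 := by
    intro z; simp only [hu]; split_ifs
    · rw [conjTranspose_one, Matrix.mul_one]
    · exact hT'
  have hux : ∀ z, u z * spinX n * (u z)ᴴ = spinX n := by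
    intro z; simp only [hu]; split_ifs
    · rw [conjTranspose_one, Matrix.mul_one, Matrix.one_mul]
    · exact hTx
  have huy : ∀ z, u z * spinY n * (u z)ᴴ = sgn z • spinY n := by
    intro z; simp only [hu, hsgn]; split_ifs
    · rw [conjTranspose_one, Matrix.mul_one, Matrix.one_mul, one_smul]
    · rw [hTy, neg_one_smul]
  have huz : ∀ z, u z * SpinOperators.spinZ n * (u z)ᴴ = sgn z • SpinOperators.spinZ n := by
    intro z; simp only [hu, hsgn]; split_ifs
    · rw [conjTranspose_one, Matrix.mul_one, Matrix.one_mul, one_smul]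
    · rw [hTz, neg_one_smul]
  have h01 : ∀ t : ZMod 2, t = 0 ∨ t = 1 := by decide
  have hsgn1 : ∀ x, sgn x = 1 ∨ sgn x = -1 := by
    intro x; simp only [hsgn]; split_ifs
    · exact Or.inl rfl
    · exact Or.inr rfl
  have hedge : ∀ x y, (torusGraph d (2 * k)).Adj x y → sgn x * sgn y = -1 :=
    fun x y hxy => torusParity_sign_adj k hxy
  have hsgnθ : ∀ (j : Fin d) (a : ZMod (2 * k)) (x : TorusSite d (2 * k)),
      sgn (Torus.reflectBetweenSites j a x) = -sgn x := by
    intro j a x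
    -- the reflection exchanges the sublattices: `ε(θx) = ε(x) + 1`
    have hpar : ε (Torus.reflectBetweenSites j a x) = ε x + 1 := by
      have hsplit : ∀ y : TorusSite d (2 * k),
          ε y = ZMod.castHom (dvd_mul_right 2 k) (ZMod 2) (y j) +
            ∑ i ∈ univ.erase j, ZMod.castHom (dvd_mul_right 2 k) (ZMod 2) (y i) := fun y =>
        (Finset.add_sum_erase univ
          (fun i => ZMod.castHom (dvd_mul_right 2 k) (ZMod 2) (y i)) (mem_univ j)).symm
      have hθj : (Torus.reflectBetweenSites j a x) j = 2 * a + 1 - x j := by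
        rw [Torus.reflectBetweenSites_apply, Function.update_self]
      have hθi : ∀ i ∈ univ.erase j, (Torus.reflectBetweenSites j a x) i = x i := fun i hi => by
        rw [Torus.reflectBetweenSites_apply, Function.update_of_ne (ne_of_mem_erase hi)]
      have h2 : (ZMod.castHom (dvd_mul_right 2 k) (ZMod 2)) (2 * a + 1 - x j) =
          ZMod.castHom (dvd_mul_right 2 k) (ZMod 2) (x j) + 1 := by
        rw [map_sub, map_add, map_mul, map_one, map_ofNat]
        have h2' : (2 : ZMod 2) = 0 := by decide
        rw [h2', zero_mul, zero_add]
        generalize (ZMod.castHom (dvd_mul_right 2 k) (ZMod 2)) (x j) = c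
        rcases h01 c with rfl | rfl <;> decide
      rw [hsplit, hsplit x, hθj, Finset.sum_congr rfl fun i hi => by rw [hθi i hi], h2]
      ring
    simp only [hsgn, hpar]
    rcases h01 (ε x) with h0 | h1
    · rw [if_pos h0, if_neg (show ¬(ε x + 1 = 0) by rw [h0]; decide)]
    · rw [if_neg (show ¬(ε x = 0) by rw [h1]; decide),
        if_pos (show ε x + 1 = 0 by rw [h1]; decide), neg_neg]
  -- the product unitary and its single-site actions
  set W := productOp u with hW
  have hWW : W * Wᴴ = 1 := by rw [hW]; exact productOp_mul_conjTranspose hua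
  have hWW' : Wᴴ * W = 1 := by rw [hW]; exact productOp_conjTranspose_mul hua'
  have hW0 : ∀ x, W * siteSpin n x 0 * Wᴴ = siteSpin n x 0 := fun x => by
    rw [hW, productOp_conj_siteSpin hua, spinVec_zero, hux]; rfl
  have hW1 : ∀ x, W * siteSpin n x 1 * Wᴴ = sgn x • siteSpin n x 1 := fun x => by
    rw [hW, productOp_conj_siteSpin hua, spinVec_one, huy, onSite_smul']; rfl
  have hW2 : ∀ x, W * siteSpin n x 2 * Wᴴ = sgn x • siteSpin n x 2 := fun x => by
    rw [hW, productOp_conj_siteSpin hua, spinVec_two, huz, onSite_smul']; rfl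
  -- bond actions
  have hmul : ∀ A B : Op (TorusSite d (2 * k)) (n + 1),
      W * (A * B) * Wᴴ = (W * A * Wᴴ) * (W * B * Wᴴ) := fun A B => by
    rw [hW]; exact productOp_conj_mul hua' A B
  have hb : ∀ (α : Fin 3) (x y : TorusSite d (2 * k)), W * spinBond n α x y * Wᴴ =
      (1 / 2 : ℂ) • ((W * siteSpin n x α * Wᴴ) * (W * siteSpin n y α * Wᴴ) +
        (W * siteSpin n y α * Wᴴ) * (W * siteSpin n x α * Wᴴ)) := by
    intro α x y
    rw [spinBond, Matrix.mul_smul, Matrix.smul_mul, Matrix.mul_add, Matrix.add_mul, hmul, hmul]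
  have hb0 : ∀ x y : TorusSite d (2 * k), W * spinBond n 0 x y * Wᴴ = spinBond n 0 x y := by
    intro x y; rw [hb, hW0, hW0]; rfl
  have hsflip : ∀ (α : Fin 3) (x y : TorusSite d (2 * k)), sgn x * sgn y = -1 →
      (1 / 2 : ℂ) • ((sgn x • siteSpin n x α) * (sgn y • siteSpin n y α) +
        (sgn y • siteSpin n y α) * (sgn x • siteSpin n x α)) = -spinBond n α x y := by
    intro α x y hxy
    rw [smul_mul_smul_comm, smul_mul_smul_comm, mul_comm (sgn y) (sgn x), hxy, neg_one_smul,
      neg_one_smul, ← neg_add, smul_neg]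
    rfl
  have hb1 : ∀ x y : TorusSite d (2 * k), (torusGraph d (2 * k)).Adj x y →
      W * spinBond n 1 x y * Wᴴ = -spinBond n 1 x y := by
    intro x y hxy; rw [hb, hW1, hW1, hsflip 1 x y (hedge x y hxy)]
  have hb2 : ∀ x y : TorusSite d (2 * k), (torusGraph d (2 * k)).Adj x y →
      W * spinBond n 2 x y * Wᴴ = -spinBond n 2 x y := by
    intro x y hxy; rw [hb, hW2, hW2, hsflip 2 x y (hedge x y hxy)]
  have hadj : ∀ e ∈ E, ∀ x y, e = s(x, y) → (torusGraph d (2 * k)).Adj x y := by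
    intro e he x y hexy
    subst hexy
    rwa [hE, SimpleGraph.mem_edgeFinset] at he
  -- the rotated Hamiltonians, bond by bond
  have hrot : ∀ Δ : ℝ, W * xxzHamiltonian n (torusGraph d (2 * k)) (-1) Δ * Wᴴ =
      -∑ e ∈ E, Sym2.lift ⟨fun x y => spinBond n 0 x y - spinBond n 1 x y -
        (Δ : ℂ) • spinBond n 2 x y, fun x y => by simp only [spinBond_comm]⟩ e := by
    intro Δ
    rw [xxzHamiltonian, ← hE, Matrix.mul_smul, Matrix.smul_mul, Finset.mul_sum, Finset.sum_mul,
      Complex.ofReal_neg, Complex.ofReal_one, neg_one_smul]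
    congr 1
    refine sum_congr rfl fun e he => ?_
    induction e using Sym2.ind with
    | h x y =>
      have hxy := hadj _ he x y rfl
      simp only [Sym2.lift_mk, Matrix.mul_add, Matrix.add_mul, Matrix.mul_smul, Matrix.smul_mul,
        hb0, hb1 x y hxy, hb2 x y hxy, smul_neg]
      abel
  refine ⟨W, sgn, hWW, hWW', hW0, hW1, hW2, hsgn1, hedge, hsgnθ, ?_, ?_⟩
  · -- `Δ = 0`: `H♭(0)`, bond term `-b⁰ + b¹`
    rw [xyTorus, hrot 0, xyRealFieldHamiltonian, ← hE, ← Finset.sum_neg_distrib]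
    refine sum_congr rfl fun e _ => ?_
    induction e using Sym2.ind with
    | h x y =>
      simp only [Sym2.lift_mk, xyRealBond, Pi.zero_apply, sub_self, Complex.ofReal_zero, zero_smul,
        sub_zero, ne_eq, OfNat.ofNat_ne_zero, not_false_eq_true, zero_pow, zero_div, add_zero,
        neg_sub]
      abel
  · -- `Δ < 0`: `(-Δ)·H'(s², -s², 0)`, `(-Δ)s² = 1`
    intro Δ hΔ
    set t : ℝ := Real.sqrt (-Δ)⁻¹ ^ 2 with ht
    have ht' : t = (-Δ)⁻¹ := by rw [ht, Real.sq_sqrt (inv_nonneg.2 (by linarith))]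
    have hΔt : ((-Δ : ℝ) : ℂ) * (t : ℂ) = 1 := by
      rw [← Complex.ofReal_mul, ht', mul_inv_cancel₀ (by linarith), Complex.ofReal_one]
    rw [hrot Δ, xyzRealFieldHamiltonian, ← hE, Finset.smul_sum, ← Finset.sum_neg_distrib]
    refine sum_congr rfl fun e _ => ?_
    induction e using Sym2.ind with
    | h x y =>
      simp only [Sym2.lift_mk, xyzRealBond, Pi.zero_apply, sub_self, Complex.ofReal_zero, zero_smul,
        sub_zero, ne_eq, OfNat.ofNat_ne_zero, not_false_eq_true, zero_pow, zero_div, add_zero]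
      have e1 : ((-Δ : ℝ) : ℂ) • (((t : ℝ) : ℂ) • spinBond n 0 x y) = spinBond n 0 x y := by
        rw [smul_smul, hΔt, one_smul]
      have e2 : ((-Δ : ℝ) : ℂ) • (((-t : ℝ) : ℂ) • spinBond n 1 x y) = -spinBond n 1 x y := by
        rw [show ((-t : ℝ) : ℂ) = -((t : ℝ) : ℂ) from Complex.ofReal_neg t, smul_smul, mul_neg, hΔt,
          neg_one_smul]
      have e3 : ((-Δ : ℝ) : ℂ) • spinBond n 2 x y = -((Δ : ℂ) • spinBond n 2 x y) := by
        rw [Complex.ofReal_neg, neg_smul]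
      rw [smul_sub, smul_sub, smul_neg, e1, e2, e3]
      abel

end Literature.MathematicalPhysics.QuantumLattice

end
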